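import Literature.AlgebraicGeometry.Frobenioids.EquivalenceThm34iiiOfPreSteps
import Literature.AlgebraicGeometry.Frobenioids.EquivalenceThm34ivvOfThm34iii
import HarnessLib

/-!
# Frobenioids I, Theorem 3.4: the typed items (iii), (iv), (v) — in the 2008 wording — follow from the
# typed item (ii) alone

Mochizuki, *The geometry of Frobenioids I: the general theory*, Kyushu J. Math. **62** (2008)
293–400, Thm. 3.4, kurims pp. 62–63 [cite: MochizukiFrdI2008, Thm. 3.4 (iii) p.62]; proof of (iii)
pp. 64–66 ("by assertions (i), (ii), `Ψ` preserves … pre-steps"), of (iv) pp. 66–67 ("by assertion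
(iii) …"), of (v) pp. 67–69. In print the base hypothesis (d) "`D₁`, `D₂` of FSMFF-type" of "standard
type" enters the proofs of (iii)–(v) ONLY through assertion (ii).

PROOF-ONLY file (abc-iut cell, seat abc-iut-L1-t13 gen 2; `plan/GAP-LEDGER.md` row G-L1d8-1, by-product
assigned by abc-iut-L1-lead R98 (3)(b); cell record PR-1 = "the printed route of Thm. 3.4 (ii) is broken
over bases of FSMFF-type in the 2008 wording that are not of FSMFF-type in the author's revised (2024)
sense"). The kernel now holds "(ii) for `Ψ`, `Ψ⁻¹` ⟹ (iii)" (abc-iut-L1-t11,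
`FrdI.OfPreSteps.thm34iii_ofFunctor`, no base hypothesis) and "(ii) + (iii) ⟹ (iv)", "(iii) ⟹ (v)"
(abc-iut-w4-d088, `FrdI.thm34iv_ofFunctor_of_thm34ii_thm34iii`, `FrdI.thm34v_ofFunctor_of_thm34iii`).
This file composes them into the statement the cell's bookkeeping needs: at the operations
`S_i := PreFrobenioidData.ofFunctor Φ_i F_i` of ANY two Frobenioids, the typed 2008-worded
`PreFrobenioidData.Thm34ii` for `Ψ` and for `Ψ⁻¹` implies the typed `Thm34iii`, `Thm34iv`, `Thm34v`
(`FrdI.thm34iii_ofFunctor_of_thm34ii`, `…iv…`, `…v…`); and at the level of the cell's NAMED FACTS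
(`CategoryTheoreticityFacts.lean`, abc-iut-L1-t3): `FrdI.thm34iii_of_thm34ii : Thm34ii → Thm34iii`,
`FrdI.thm34iv_of_thm34ii : Thm34ii → Thm34iv`, `FrdI.thm34v_of_thm34ii : Thm34ii → Thm34v`,
`FrdI.thm34iii_iv_v_of_thm34ii`. CONSEQUENCE FOR THE RECORD: the named facts Thm. 3.4 (iii), (iv), (v)
"open as typed" carry NO residual beyond the single named fact Thm. 3.4 (ii) in its 2008 wording
(PR-1); over bases of FSMFF-type in the revised sense all of (ii)–(v) are discharged
(`FrdI.thm34ii_ofFunctor_of_isOfFSMFFType2024`, `FrdI.thm34iii_ofFunctor_of_isOfFSMFFType2024`, …)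
[cite: MochizukiFrdIComments2024, (28) p.3]. Nothing of [FrdI] is restated as a named fact; no statement
is strengthened; no new definition; nothing here bears on the disputed [IUTchIII] Cor. 3.12.
-/

namespace Literature.AlgebraicGeometry.Frobenioids

namespace FrdI

open CategoryTheory PreFrobenioidData

universe w v v' u u'

section Two

variable {D₁ : Type u} [Category.{v} D₁] {Φ₁ : D₁ᵒᵖ ⥤ CommMonCat.{w}} {C₁ : Type u'} [Category.{v'} C₁]
  {D₂ : Type u} [Category.{v} D₂] {Φ₂ : D₂ᵒᵖ ⥤ CommMonCat.{w}} {C₂ : Type u'} [Category.{v'} C₂]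
  {F₁ : C₁ ⥤ ElemFrobenioid Φ₁} {F₂ : C₂ ⥤ ElemFrobenioid Φ₂}

/-- **The typed Theorem 3.4 (ii) implies the typed Theorem 3.4 (iii)** (both in the 2008 wording, at
`S_i := ofFunctor Φ_i F_i`, for every pair of Frobenioids): the per-instance `PreFrobenioidData.Thm34ii`
for `Ψ` and for `Ψ⁻¹` — whose hypotheses "quasi-isotropic" and "`D_i` of FSMFF-type [2008]" are
supplied by (a) standard type — yields `PreFrobenioidData.Thm34iii S₁ S₂ Ψ` (through abc-iut-L1-t11's
`FrdI.OfPreSteps.thm34iii_ofFunctor`). [cite: MochizukiFrdI2008, Thm. 3.4 (iii) p.62] -/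
theorem thm34iii_ofFunctor_of_thm34ii (hF₁ : PreFrobenioid.IsFrobenioid F₁)
    (hF₂ : PreFrobenioid.IsFrobenioid F₂) (Ψ : C₁ ≌ C₂)
    (h2 : (ofFunctor Φ₁ F₁).Thm34ii (ofFunctor Φ₂ F₂) Ψ)
    (h2' : (ofFunctor Φ₂ F₂).Thm34ii (ofFunctor Φ₁ F₁) Ψ.symm) :
    (ofFunctor Φ₁ F₁).Thm34iii (ofFunctor Φ₂ F₂) Ψ := fun hs₁ hs₂ hB => by
  obtain ⟨h₁₂, -, hG⟩ := h2 hs₁.quasiIsotropic hs₂.quasiIsotropic hs₁.fsmff hs₂.fsmff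
  obtain ⟨h₂₁, -, hG'⟩ := h2' hs₂.quasiIsotropic hs₁.quasiIsotropic hs₂.fsmff hs₁.fsmff
  exact OfPreSteps.thm34iii_ofFunctor hF₁ hF₂ Ψ h₁₂ h₂₁ hG hG' hs₁ hs₂ hB

/-- **The typed Theorem 3.4 (ii) implies the typed Theorem 3.4 (iv)** (2008 wording, every pair of
Frobenioids): (ii) for `Ψ`, `Ψ⁻¹` gives (iii) for `Ψ`, `Ψ⁻¹` (previous theorem), and (ii)+(iii) give (iv)
(abc-iut-w4-d088's `FrdI.thm34iv_ofFunctor_of_thm34ii_thm34iii`). [cite: MochizukiFrdI2008, Thm. 3.4 (iv) p.63] -/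
theorem thm34iv_ofFunctor_of_thm34ii (hF₁ : PreFrobenioid.IsFrobenioid F₁)
    (hF₂ : PreFrobenioid.IsFrobenioid F₂) (Ψ : C₁ ≌ C₂)
    (h2 : (ofFunctor Φ₁ F₁).Thm34ii (ofFunctor Φ₂ F₂) Ψ)
    (h2' : (ofFunctor Φ₂ F₂).Thm34ii (ofFunctor Φ₁ F₁) Ψ.symm) :
    (ofFunctor Φ₁ F₁).Thm34iv (ofFunctor Φ₂ F₂) Ψ :=
  thm34iv_ofFunctor_of_thm34ii_thm34iii hF₁ hF₂ Ψ h2 h2' (thm34iii_ofFunctor_of_thm34ii hF₁ hF₂ Ψ h2 h2')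
    (thm34iii_ofFunctor_of_thm34ii hF₂ hF₁ Ψ.symm h2' h2)

/-- **The typed Theorem 3.4 (ii) implies the typed Theorem 3.4 (v)** (2008 wording, every pair of
Frobenioids): through (iii) for `Ψ`, `Ψ⁻¹` and abc-iut-w4-d088's `FrdI.thm34v_ofFunctor_of_thm34iii`
(abc-iut-L1-d4's `PreFrobenioid.thm34v_conclusion_of_preserves_baseIso` over slim bases).
[cite: MochizukiFrdI2008, Thm. 3.4 (v) p.63] -/
theorem thm34v_ofFunctor_of_thm34ii (hF₁ : PreFrobenioid.IsFrobenioid F₁)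
    (hF₂ : PreFrobenioid.IsFrobenioid F₂) (Ψ : C₁ ≌ C₂)
    (h2 : (ofFunctor Φ₁ F₁).Thm34ii (ofFunctor Φ₂ F₂) Ψ)
    (h2' : (ofFunctor Φ₂ F₂).Thm34ii (ofFunctor Φ₁ F₁) Ψ.symm) :
    (ofFunctor Φ₁ F₁).Thm34v (ofFunctor Φ₂ F₂) Ψ :=
  thm34v_ofFunctor_of_thm34iii hF₁ hF₂ Ψ (thm34iii_ofFunctor_of_thm34ii hF₁ hF₂ Ψ h2 h2')
    (thm34iii_ofFunctor_of_thm34ii hF₂ hF₁ Ψ.symm h2' h2)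

end Two

/-! ### At the level of the named facts of `CategoryTheoreticityFacts.lean` -/

/-- **The named fact [FrdI] Thm. 3.4 (iii) follows from the named fact Thm. 3.4 (ii)** (both universally
quantified over pairs of Frobenioids and equivalences, 2008 wording; (ii) is applied to `Ψ` and to `Ψ⁻¹`).
[cite: MochizukiFrdI2008, Thm. 3.4 (iii) p.62] -/
theorem thm34iii_of_thm34ii (h2 : Thm34ii.{w, v, v', u, u'}) : Thm34iii.{w, v, v', u, u'} :=
  fun F₁ F₂ hF₁ hF₂ Ψ =>
    thm34iii_ofFunctor_of_thm34ii hF₁ hF₂ Ψ (h2 F₁ F₂ hF₁ hF₂ Ψ) (h2 F₂ F₁ hF₂ hF₁ Ψ.symm)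

/-- **The named fact [FrdI] Thm. 3.4 (iv) follows from the named fact Thm. 3.4 (ii).**
[cite: MochizukiFrdI2008, Thm. 3.4 (iv) p.63] -/
theorem thm34iv_of_thm34ii (h2 : Thm34ii.{w, v, v', u, u'}) : Thm34iv.{w, v, v', u, u'} :=
  thm34iv_of_thm34ii_thm34iii h2 (thm34iii_of_thm34ii h2)

/-- **The named fact [FrdI] Thm. 3.4 (v) follows from the named fact Thm. 3.4 (ii).**
[cite: MochizukiFrdI2008, Thm. 3.4 (v) p.63] -/
theorem thm34v_of_thm34ii (h2 : Thm34ii.{w, v, v', u, u'}) : Thm34v.{w, v, v', u, u'} :=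
  thm34v_of_thm34iii (thm34iii_of_thm34ii h2)

/-- **Record for the cell's residual PR-1**: the named facts Thm. 3.4 (iii), (iv), (v), all "open as
typed" in the 2008 wording, are TOGETHER implied by the single named fact Thm. 3.4 (ii).
[cite: MochizukiFrdI2008, Thm. 3.4 (iii) p.62] -/
theorem thm34iii_iv_v_of_thm34ii (h2 : Thm34ii.{w, v, v', u, u'}) :
    Thm34iii.{w, v, v', u, u'} ∧ Thm34iv.{w, v, v', u, u'} ∧ Thm34v.{w, v, v', u, u'} :=
  ⟨thm34iii_of_thm34ii h2, thm34iv_of_thm34ii h2, thm34v_of_thm34ii h2⟩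

end FrdI

end Literature.AlgebraicGeometry.Frobenioids
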